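import Mathlib.Data.Finset.Sym
import Mathlib.Data.Fintype.Sigma
import Mathlib.Data.Fintype.Sum
import Mathlib.Data.Fintype.Prod
import Mathlib.Data.Fintype.Option
import Mathlib.Data.Fintype.BigOperators
import Mathlib.Algebra.BigOperators.Ring.Finset
import Mathlib.Algebra.Ring.Parity
import Mathlib.Tactic.Ring
import Literature.Barriers.PneNP.TSPExtensionComplexityMatchings
import HarnessLib

/-!
# The Tseitin → `MOD2` gadget (Buss–Grigoriev–Impagliazzo–Pitassi; Grigoriev 2001, Lemma 10), I:
# points, windows, free points and local matchings

Grigoriev 2001, Lemma 10: "For all `k` the Boolean binomial system `PTS_k(2)` [Tseitin mod 2 on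
a `k`-vertex `r`-regular graph] is `(4r, 4r)`-reducible to `MOD2_{k(1+2r)}`", i.e. to "the
complete graph on `k(1+2r)` points has a perfect matching". This file starts the combinatorial
substance of that reduction for an arbitrary loop-free multigraph given by EDGE LABELS
(`LGraph`: labels `E ⊆ ℕ`, endpoints `ends e = (u, v)`, `u ≠ v`; `star v` = labels at `v`,
`other v e` = the far endpoint), plus `npad` isolated PADDING PAIRS (to reach every large size):

* the point set `Pt G npad = (Σ v, Option (star v × Bool)) ⊕ (Fin npad × Bool)` — at each vertex
  `v` a centre (`none`) and, for each edge label `e` at `v`, two points `a_{v,e} = (e,false)`,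
  `b_{v,e} = (e,true)` (`bpt v e`), `1 + 2 deg v` points per vertex;
* WINDOWS `W p` (`= star v` on the gadget of `v`, `∅` on the padding): the Tseitin variables a
  point may depend on; the cross edge `cedge v e = {b_{v,e}, b_{u,e}}` of a label `e = vu`;
* for a PATTERN `A ⊆ ℕ` (the labels `e` with Tseitin value `x_e = 1`): the FREE points
  `free v A` of the gadget of `v` (all but the `b_{v,e}`, `e ∈ A`), of number
  `1 + 2 deg v - |A ∩ star v|` (`card_free_add`), even iff the Tseitin constraint "oddly many
  incident `x_e = 1`" holds on `A` (`even_card_free_iff`); and `localM v A`, a fixed perfect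
  matching of the free points in that case (nothing otherwise), depending only on `A ∩ star v`.

Part Ib (`Mod2TseitinGadgetMatching.lean`) assembles the matching `M A` of a pattern and its
covered set; Part II shows that `[s ∈ M A]` depends only on `A ∩` (windows of the endpoints of
`s`) and derives the pointwise form of the `MOD2` equations; Part III substitutes into a
Grigoriev–Schoenebeck moment functional.

## References

* D. Grigoriev, *Linear lower bound on degrees of Positivstellensatz calculus proofs for the
  parity*, Theoret. Comput. Sci. 259 (2001) 613–622, Lemma 10 (and [4, 5] there =
  Buss–Grigoriev–Impagliazzo–Pitassi, JCSS 62 (2001), §7). [Grigoriev2001TCS]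
-/

noncomputable section

open Finset
open Literature.Barriers.PneNP (IsPMOn exists_isPMOn_of_even)

namespace Literature.Computability.Complexity

/-! ### Loop-free multigraphs by edge labels -/

/-- A loop-free multigraph presented by EDGE LABELS: a finite set `E ⊆ ℕ` of labels and for each
label its two (distinct) endpoints. (The Tseitin variables are indexed by the labels; parallel
edges are allowed.) [cite: Grigoriev2001TCS, §3 (the graphs `G_k` of the Tseitin tautologies)] -/
structure LGraph (V : Type*) where
  /-- the edge labels -/
  E : Finset ℕ
  /-- the endpoints of a label -/
  ends : ℕ → V × V
  /-- no loops -/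
  ne : ∀ e ∈ E, (ends e).1 ≠ (ends e).2

namespace LGraph

variable {V : Type*} [DecidableEq V] (G : LGraph V)

/-- The labels of the edges at `v` (the scope of the Tseitin equation of `v`).
[cite: Grigoriev2001TCS, §3 (the equation of a node: the edges incident to it)] -/
def star (v : V) : Finset ℕ := G.E.filter fun e => (G.ends e).1 = v ∨ (G.ends e).2 = v

/-- The other endpoint of the edge `e` seen from `v`. [cite: Grigoriev2001TCS, §3] -/
def other (v : V) (e : ℕ) : V := if (G.ends e).1 = v then (G.ends e).2 else (G.ends e).1

variable {G}

/-- Membership in a star. [cite: Grigoriev2001TCS, §3] -/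
theorem mem_star {v : V} {e : ℕ} :
    e ∈ G.star v ↔ e ∈ G.E ∧ ((G.ends e).1 = v ∨ (G.ends e).2 = v) :=
  mem_filter

/-- Stars consist of edge labels. [cite: Grigoriev2001TCS, §3] -/
theorem star_subset (v : V) : G.star v ⊆ G.E := filter_subset _ _

/-- The other endpoint is a different vertex (no loops). [cite: Grigoriev2001TCS, §3] -/
theorem other_ne {v : V} {e : ℕ} (he : e ∈ G.star v) : G.other v e ≠ v := by
  obtain ⟨hE, h⟩ := mem_star.1 he
  have hne := G.ne e hE
  unfold other
  split_ifs with h1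
  · rw [← h1]; exact hne.symm
  · rcases h with h | h
    · exact absurd h h1
    · rw [← h]; exact hne

/-- The edge is also at its other endpoint. [cite: Grigoriev2001TCS, §3] -/
theorem mem_star_other {v : V} {e : ℕ} (he : e ∈ G.star v) : e ∈ G.star (G.other v e) := by
  obtain ⟨hE, h⟩ := mem_star.1 he
  refine mem_star.2 ⟨hE, ?_⟩
  unfold other
  split_ifs with h1
  · exact Or.inr rfl
  · exact Or.inl rfl

/-- `other` is an involution on the endpoints. [cite: Grigoriev2001TCS, §3] -/
theorem other_other {v : V} {e : ℕ} (he : e ∈ G.star v) : G.other (G.other v e) e = v := by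
  obtain ⟨hE, h⟩ := mem_star.1 he
  have hne := G.ne e hE
  unfold other
  by_cases h1 : (G.ends e).1 = v
  · rw [if_pos h1, if_neg hne]
    exact h1
  · rw [if_neg h1, if_pos rfl]
    rcases h with h | h
    · exact absurd h h1
    · exact h

/-- An edge has exactly the two endpoints `v` and `other v e`. [cite: Grigoriev2001TCS, §3] -/
theorem eq_or_eq_other {v w : V} {e : ℕ} (hv : e ∈ G.star v) (hw : e ∈ G.star w) :
    w = v ∨ w = G.other v e := by
  obtain ⟨-, h⟩ := mem_star.1 hv
  obtain ⟨-, h'⟩ := mem_star.1 hw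
  unfold other
  by_cases h1 : (G.ends e).1 = v
  · rw [if_pos h1]
    rcases h' with h' | h'
    · exact Or.inl (h'.symm.trans h1)
    · exact Or.inr h'.symm
  · rw [if_neg h1]
    rcases h with h | h
    · exact absurd h h1
    rcases h' with h' | h'
    · exact Or.inr h'.symm
    · exact Or.inl (h'.symm.trans h)

end LGraph

/-! ### The points of the reduction -/

namespace Mod2Gadget

section Points

variable {V : Type*} [DecidableEq V] (G : LGraph V) (npad : ℕ)

/-- **The points** of `MOD2` in the reduction: for each vertex `v` a centre (`none`) and, for
each edge label `e` at `v`, the points `a_{v,e} = (e, false)` and `b_{v,e} = (e, true)`; plus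
`npad` padding pairs. [cite: Grigoriev2001TCS, Lemma 10 ("MOD2_{k(1+2r)}": 1 + 2r points per node)] -/
abbrev Pt : Type _ := (Σ v : V, Option (↥(G.star v) × Bool)) ⊕ (Fin npad × Bool)

set_option synthInstance.maxSize 1024 in
/-- Decidable equality of points (the default instance search exceeds its size bound on this
nested type; this is Mathlib's instance, found with a larger bound and registered under a name
so that later searches are immediate). [cite: Grigoriev2001TCS, Lemma 10] -/
instance instDecidableEqPt : DecidableEq (Pt G npad) := inferInstance

set_option synthInstance.maxSize 1024 in
/-- Decidable equality of unordered pairs of points (same remark). [cite: Grigoriev2001TCS, Lemma 10] -/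
instance instDecidableEqSym2Pt : DecidableEq (Sym2 (Pt G npad)) := inferInstance

variable {G npad}

/-- The point `b_{v,e}` (matched ACROSS the edge `e` when `x_e = 1`). [cite: Grigoriev2001TCS, Lemma 10] -/
def bpt (v : V) (e : ↥(G.star v)) : Pt G npad := Sum.inl ⟨v, some (e, true)⟩

/-- The vertex of a gadget point is determined. [cite: Grigoriev2001TCS, Lemma 10] -/
theorem fst_eq_of_inl_eq {v w : V} {o : Option (↥(G.star v) × Bool)}
    {o' : Option (↥(G.star w) × Bool)} (h : (Sum.inl ⟨v, o⟩ : Pt G npad) = Sum.inl ⟨w, o'⟩) :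
    v = w :=
  (Sigma.mk.inj_iff.1 (Sum.inl.inj h)).1

/-- Gadget points over the same vertex are equal iff their local parts are. [cite: Grigoriev2001TCS, Lemma 10] -/
theorem inl_eq_inl_iff {v : V} {o o' : Option (↥(G.star v) × Bool)} :
    (Sum.inl ⟨v, o⟩ : Pt G npad) = Sum.inl ⟨v, o'⟩ ↔ o = o' := by
  constructor
  · intro h
    exact eq_of_heq (Sigma.mk.inj_iff.1 (Sum.inl.inj h)).2
  · rintro rfl; rfl

/-- `bpt` respects equal data. [cite: Grigoriev2001TCS, Lemma 10] -/
theorem bpt_congr {v w : V} {e : ↥(G.star v)} {f : ↥(G.star w)} (hvw : v = w)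
    (hef : (e : ℕ) = f) : (bpt v e : Pt G npad) = bpt w f := by
  subst hvw
  have : e = f := Subtype.ext hef
  subst this
  rfl

/-- `bpt` is injective in both arguments. [cite: Grigoriev2001TCS, Lemma 10] -/
theorem bpt_inj {v w : V} {e : ↥(G.star v)} {f : ↥(G.star w)}
    (h : (bpt v e : Pt G npad) = bpt w f) : v = w ∧ (e : ℕ) = f := by
  have hvw : v = w := fst_eq_of_inl_eq h
  subst hvw
  have := inl_eq_inl_iff.1 h
  simp only [Option.some.injEq, Prod.mk.injEq, and_true] at this
  exact ⟨rfl, by rw [this]⟩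

/-- The WINDOW of a point: the Tseitin variables it may depend on (`star v` on the gadget of `v`,
nothing on the padding). [cite: Grigoriev2001TCS, Lemma 10 (degree `4r` of the substitution)] -/
def W : Pt G npad → Finset ℕ
  | Sum.inl ⟨v, _⟩ => G.star v
  | Sum.inr _ => ∅

/-- The window of a gadget point. [cite: Grigoriev2001TCS, Lemma 10] -/
@[simp] theorem W_inl (v : V) (o : Option (↥(G.star v) × Bool)) :
    W (Sum.inl ⟨v, o⟩ : Pt G npad) = G.star v := rfl

/-- The window of a padding point. [cite: Grigoriev2001TCS, Lemma 10] -/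
@[simp] theorem W_inr (x : Fin npad × Bool) : W (Sum.inr x : Pt G npad) = ∅ := rfl

/-- The cross edge `{b_{v,e}, b_{u,e}}` of the edge label `e = vu`, seen from `v`.
[cite: Grigoriev2001TCS, Lemma 10] -/
def cedge (v : V) (e : ↥(G.star v)) : Sym2 (Pt G npad) :=
  s(bpt v e, bpt (G.other v e) ⟨e, LGraph.mem_star_other e.2⟩)

/-- `cedge` respects equal data. [cite: Grigoriev2001TCS, Lemma 10] -/
theorem cedge_congr {v w : V} {e : ↥(G.star v)} {f : ↥(G.star w)} (hvw : v = w)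
    (hef : (e : ℕ) = f) : (cedge v e : Sym2 (Pt G npad)) = cedge w f := by
  subst hvw
  have : e = f := Subtype.ext hef
  subst this
  rfl

/-- The cross edge seen from the other endpoint is the same edge. [cite: Grigoriev2001TCS, Lemma 10] -/
theorem cedge_other (v : V) (e : ↥(G.star v)) :
    cedge (npad := npad) (G.other v e) ⟨e, LGraph.mem_star_other e.2⟩ = cedge v e := by
  conv_rhs => rw [cedge, Sym2.eq_swap]
  rw [cedge]
  congr 1
  exact bpt_congr (LGraph.other_other e.2) rfl

/-- A cross edge is not a loop. [cite: Grigoriev2001TCS, Lemma 10] -/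
theorem not_isDiag_cedge (v : V) (e : ↥(G.star v)) : ¬ (cedge v e : Sym2 (Pt G npad)).IsDiag := by
  rw [cedge, Sym2.mk_isDiag_iff]
  intro h
  exact LGraph.other_ne e.2 (bpt_inj h).1.symm

end Points

variable {V : Type*} [Fintype V] [DecidableEq V] {G : LGraph V} {npad : ℕ}

/-! ### The free points of a gadget and their local matching -/

open Classical in
/-- The points of the gadget of `v` that are FREE under the pattern `A` (not matched across an
edge): all of the gadget except the `b_{v,e}` with `e ∈ A`. [cite: Grigoriev2001TCS, Lemma 10] -/
def free (G : LGraph V) (npad : ℕ) (v : V) (A : Finset ℕ) : Finset (Pt G npad) :=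
  univ.filter fun p => ∃ o : Option (↥(G.star v) × Bool), p = Sum.inl ⟨v, o⟩ ∧
    ∀ e : ↥(G.star v), o = some (e, true) → (e : ℕ) ∉ A

/-- Membership in the free set, for a gadget point. [cite: Grigoriev2001TCS, Lemma 10] -/
theorem inl_mem_free_iff {v w : V} {o : Option (↥(G.star w) × Bool)} {A : Finset ℕ} :
    (Sum.inl ⟨w, o⟩ : Pt G npad) ∈ free G npad v A ↔
      w = v ∧ ∀ e : ↥(G.star w), o = some (e, true) → (e : ℕ) ∉ A := by
  classical
  rw [free, mem_filter]
  constructor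
  · rintro ⟨-, o', h, h'⟩
    have hwv : w = v := fst_eq_of_inl_eq h
    subst hwv
    rw [inl_eq_inl_iff] at h
    subst h
    exact ⟨rfl, h'⟩
  · rintro ⟨rfl, h⟩
    exact ⟨mem_univ _, o, rfl, h⟩

/-- Padding points are never free points of a gadget. [cite: Grigoriev2001TCS, Lemma 10] -/
theorem inr_not_mem_free {v : V} {x : Fin npad × Bool} {A : Finset ℕ} :
    (Sum.inr x : Pt G npad) ∉ free G npad v A := by
  classical
  rw [free, mem_filter]
  rintro ⟨-, o, h, -⟩
  cases h

/-- The free set depends only on `A ∩ star v`. [cite: Grigoriev2001TCS, Lemma 10] -/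
theorem free_inter (v : V) (A : Finset ℕ) : free G npad v (A ∩ G.star v) = free G npad v A := by
  ext p
  rcases p with ⟨w, o⟩ | x
  · rw [inl_mem_free_iff, inl_mem_free_iff]
    refine and_congr_right fun hw => ?_
    subst hw
    refine forall_congr' fun e => imp_congr_right fun _ => ?_
    rw [mem_inter, not_and_or]
    exact ⟨fun h => h.resolve_right (not_not.2 e.2), Or.inl⟩
  · exact ⟨fun h => absurd h inr_not_mem_free, fun h => absurd h inr_not_mem_free⟩

/-- **Size of the free set**: `|free v A| + |A ∩ star v| = 1 + 2 |star v|`.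
[cite: Grigoriev2001TCS, Lemma 10] -/
theorem card_free_add (v : V) (A : Finset ℕ) :
    (free G npad v A).card + (A ∩ G.star v).card = 1 + 2 * (G.star v).card := by
  -- the gadget of `v` and its cross-matched part
  let emb : Option (↥(G.star v) × Bool) ↪ Pt G npad :=
    ⟨fun o => Sum.inl ⟨v, o⟩, fun o o' h => inl_eq_inl_iff.1 h⟩
  let gad : Finset (Pt G npad) := univ.map emb
  let bemb : ↥(G.star v) ↪ Pt G npad :=
    ⟨fun e => Sum.inl ⟨v, some (e, true)⟩, fun e e' h => by
      have := inl_eq_inl_iff.1 h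
      simp only [Option.some.injEq, Prod.mk.injEq, and_true] at this
      exact this⟩
  let bad : Finset (Pt G npad) := ((G.star v).attach.filter fun e : ↥(G.star v) => (e : ℕ) ∈ A).map bemb
  have hgad : gad.card = 1 + 2 * (G.star v).card := by
    rw [card_map, card_univ, Fintype.card_option, Fintype.card_prod, Fintype.card_bool,
      Fintype.card_coe]
    ring
  have hbad : bad.card = (A ∩ G.star v).card := by
    rw [card_map]
    have : A ∩ G.star v = ((G.star v).attach.filter fun e : ↥(G.star v) => (e : ℕ) ∈ A).map
        (Function.Embedding.subtype _) := by
      ext e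
      rw [mem_inter, mem_map]
      constructor
      · rintro ⟨heA, hev⟩
        exact ⟨⟨e, hev⟩, mem_filter.2 ⟨mem_attach _ _, heA⟩, rfl⟩
      · rintro ⟨⟨e', he'⟩, hf, rfl⟩
        exact ⟨(mem_filter.1 hf).2, he'⟩
    rw [this, card_map]
  have hsub : bad ⊆ gad := by
    intro p hp
    obtain ⟨e, -, rfl⟩ := mem_map.1 hp
    exact mem_map.2 ⟨some (e, true), mem_univ _, rfl⟩
  have hfree : free G npad v A = gad \ bad := by
    ext p
    rw [mem_sdiff]
    rcases p with ⟨w, o⟩ | x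
    · rw [inl_mem_free_iff]
      constructor
      · rintro ⟨rfl, h⟩
        refine ⟨mem_map.2 ⟨o, mem_univ _, rfl⟩, fun hb => ?_⟩
        obtain ⟨e, he, hpe⟩ := mem_map.1 hb
        exact h e (inl_eq_inl_iff.1 hpe).symm (mem_filter.1 he).2
      · rintro ⟨hg, hb⟩
        obtain ⟨o', -, ho'⟩ := mem_map.1 hg
        have hwv : v = w := fst_eq_of_inl_eq ho'
        subst hwv
        refine ⟨rfl, fun e hoe heA => hb (mem_map.2 ⟨e, mem_filter.2 ⟨mem_attach _ _, heA⟩, ?_⟩)⟩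
        subst hoe; rfl
    · constructor
      · exact fun h => absurd h inr_not_mem_free
      · rintro ⟨hg, -⟩
        obtain ⟨o, -, h⟩ := mem_map.1 hg
        cases h
  rw [hfree, card_sdiff_of_subset hsub, hbad, hgad]
  have : (A ∩ G.star v).card ≤ 1 + 2 * (G.star v).card :=
    (card_le_card inter_subset_right).trans (by omega)
  omega

/-- **Parity of the free set**: it is even exactly when the Tseitin constraint of `v` ("an odd
number of incident `x_e = 1`") holds on the pattern. [cite: Grigoriev2001TCS, Lemma 10] -/
theorem even_card_free_iff (v : V) (A : Finset ℕ) :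
    Even (free G npad v A).card ↔ Odd (A ∩ G.star v).card := by
  have h := card_free_add (G := G) (npad := npad) v A
  have hodd : Odd ((free G npad v A).card + (A ∩ G.star v).card) := by
    rw [h]; exact ⟨(G.star v).card, by ring⟩
  rw [← Nat.not_odd_iff_even, Nat.odd_add.1 hodd, Nat.not_even_iff_odd]

open Classical in
/-- A fixed perfect matching of the free points of the gadget of `v` under the local pattern `B`
when their number is even, nothing otherwise (auxiliary to `localM`). [cite: Grigoriev2001TCS, Lemma 10] -/
def localM' (G : LGraph V) (npad : ℕ) (v : V) (B : Finset ℕ) : Finset (Sym2 (Pt G npad)) :=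
  if h : Even (free G npad v B).card then
    Classical.choose (exists_isPMOn_of_even _ (free G npad v B) rfl h)
  else ∅

/-- **The local matching** of the gadget of `v` under the pattern `A`: a fixed perfect matching
of the free points when their number is even (the Tseitin constraint of `v` holds), nothing
otherwise. Depends only on `A ∩ star v` by construction. [cite: Grigoriev2001TCS, Lemma 10] -/
def localM (G : LGraph V) (npad : ℕ) (v : V) (A : Finset ℕ) : Finset (Sym2 (Pt G npad)) :=
  localM' G npad v (A ∩ G.star v)

/-- The local matching is a perfect matching of the free points when these are evenly many.
[cite: Grigoriev2001TCS, Lemma 10] -/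
theorem isPMOn_localM {v : V} {A : Finset ℕ} (h : Even (free G npad v A).card) :
    IsPMOn (free G npad v A) (localM G npad v A) := by
  have h' : Even (free G npad v (A ∩ G.star v)).card := by rwa [free_inter]
  rw [localM, localM', dif_pos h', ← free_inter v A]
  exact Classical.choose_spec (exists_isPMOn_of_even _ _ rfl h')

/-- … and empty otherwise. [cite: Grigoriev2001TCS, Lemma 10] -/
theorem localM_eq_empty {v : V} {A : Finset ℕ} (h : ¬ Even (free G npad v A).card) :
    localM G npad v A = ∅ := by
  have h' : ¬ Even (free G npad v (A ∩ G.star v)).card := by rwa [free_inter]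
  rw [localM, localM', dif_neg h']

/-- The local matching depends only on `A ∩ star v`. [cite: Grigoriev2001TCS, Lemma 10] -/
theorem localM_inter (v : V) (A : Finset ℕ) :
    localM G npad v (A ∩ G.star v) = localM G npad v A := by
  show localM' G npad v (A ∩ G.star v ∩ G.star v) = localM' G npad v (A ∩ G.star v)
  rw [inter_assoc, inter_self]

end Mod2Gadget

end Literature.Computability.Complexity
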